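import Summits.Ventures.Crystal3D.Bulk.CapX2CheckI
import HarnessLib

/-!
# Dense trivariate polynomials over `ℚ` as kernel data (`P3`), with evaluation and zero-padding equivalence

HONEST FRAMING. Venture `Summits/Ventures/Crystal3D` (cell `pub-crystal3d`, phase 2; seat p1). Bookkeeping
for the kernel replay of the X2 inequalities (II)/(III) (lead g5 03:46:24Z; consumers: typer-bulk's
tensor-Bernstein branch-and-bound, p2's SOS identities, and `Bulk/CapX2Poly3.lean`). Nothing geometric.
* `P2 = List (List ℚ)` (powers of `v`, then the `t`-coefficient list), `P3 = List P2` (powers of `u` first);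
  real evaluation `eval2`/`eval3` (nested Horner over p3's `upolyEval`), rational evaluation `eval3Q`;
* `add3`, `scale3`, `mul3` (and the `P2` versions), `cst3`, `ofU`, `ofV`, `ofT`, `sum3`, each with its
  evaluation lemma — structural recursion on lists, reusing p3's `CapCut.padd/pscale/pmul`;
* ZERO-PADDING EQUIVALENCE `eqv1/eqv2/eqv3` (lists that differ only by trailing zeros evaluate equally:
  `eval3_congr_of_eqv3`) and its SLICED form `checkSlices` / `eval3_congr_of_slices`: a literal tensor can
  be certified equal-in-value to a computed one one `u`-degree at a time (kernel laziness then only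
  computes that slice), which is how a large computed polynomial is exported as literal data without
  exceeding the per-declaration reduction budget.
-/

open Finset
open Literature.Geometry.DiscreteGeometry Literature.Geometry.DiscreteGeometry.BachocVallentin
open Summit.Ventures.Crystal3D.CapCut

namespace Summit.Ventures.Crystal3D.CapX2

/-! ### Dense bivariate / trivariate polynomials over `ℚ` -/

/-- A bivariate polynomial in `(v, t)`: list over powers of `v` of coefficient lists in `t`. -/
abbrev P2 := List (List ℚ)

/-- A trivariate polynomial in `(u, v, t)`: list over powers of `u` of `P2`'s. -/
abbrev P3 := List P2

/-- Real evaluation of a `P2` (Horner in `v`, `upolyEval` in `t`). -/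
def eval2 : P2 → ℝ → ℝ → ℝ
  | [], _, _ => 0
  | l :: p, v, t => upolyEval l t + v * eval2 p v t

/-- Real evaluation of a `P3` (Horner in `u`). -/
def eval3 : P3 → ℝ → ℝ → ℝ → ℝ
  | [], _, _, _ => 0
  | q :: p, u, v, t => eval2 q v t + u * eval3 p u v t

/-- Rational Horner evaluation of a coefficient list. -/
def qeval (l : List ℚ) (x : ℚ) : ℚ := l.foldr (fun c acc => c + x * acc) 0

/-- Rational evaluation of a `P2`. -/
def eval2Q : P2 → ℚ → ℚ → ℚ
  | [], _, _ => 0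
  | l :: p, v, t => qeval l t + v * eval2Q p v t

/-- Rational evaluation of a `P3` (for numeric spot checks by `decide`). -/
def eval3Q : P3 → ℚ → ℚ → ℚ → ℚ
  | [], _, _, _ => 0
  | q :: p, u, v, t => eval2Q q v t + u * eval3Q p u v t

/-- Sum of `P2`'s. -/
def add2 : P2 → P2 → P2
  | [], q => q
  | a :: p, [] => a :: p
  | a :: p, b :: q => padd a b :: add2 p q

/-- `add2` is addition. -/
theorem eval2_add2 (p q : P2) (v t : ℝ) : eval2 (add2 p q) v t = eval2 p v t + eval2 q v t := by
  induction p generalizing q with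
  | nil => simp [add2, eval2]
  | cons a p ih =>
    cases q with
    | nil => simp [add2, eval2]
    | cons b q => simp only [add2, eval2, eval_padd, ih]; ring

/-- Sum of `P3`'s. -/
def add3 : P3 → P3 → P3
  | [], q => q
  | a :: p, [] => a :: p
  | a :: p, b :: q => add2 a b :: add3 p q

/-- `add3` is addition. -/
theorem eval3_add3 (p q : P3) (u v t : ℝ) : eval3 (add3 p q) u v t = eval3 p u v t + eval3 q u v t := by
  induction p generalizing q with
  | nil => simp [add3, eval3]
  | cons a p ih =>
    cases q with
    | nil => simp [add3, eval3]
    | cons b q => simp only [add3, eval3, eval2_add2, ih]; ring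

/-- Scalar multiple of a `P2`. -/
def scale2 (c : ℚ) (p : P2) : P2 := p.map (pscale c)

/-- `scale2` is scalar multiplication. -/
theorem eval2_scale2 (c : ℚ) (p : P2) (v t : ℝ) : eval2 (scale2 c p) v t = (c : ℝ) * eval2 p v t := by
  induction p with
  | nil => simp [scale2, eval2]
  | cons a p ih =>
    simp only [scale2, List.map_cons, eval2, eval_pscale] at ih ⊢
    rw [ih]; ring

/-- Scalar multiple of a `P3`. -/
def scale3 (c : ℚ) (p : P3) : P3 := p.map (scale2 c)

/-- `scale3` is scalar multiplication. -/
theorem eval3_scale3 (c : ℚ) (p : P3) (u v t : ℝ) :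
    eval3 (scale3 c p) u v t = (c : ℝ) * eval3 p u v t := by
  induction p with
  | nil => simp [scale3, eval3]
  | cons a p ih =>
    simp only [scale3, List.map_cons, eval3, eval2_scale2] at ih ⊢
    rw [ih]; ring

/-- Product of a `t`-coefficient list with a `P2` (multiplies every `t`-list). -/
def mulL2 (l : List ℚ) (q : P2) : P2 := q.map (pmul l)

/-- `mulL2` is multiplication by a polynomial in `t`. -/
theorem eval2_mulL2 (l : List ℚ) (q : P2) (v t : ℝ) :
    eval2 (mulL2 l q) v t = upolyEval l t * eval2 q v t := by
  induction q with
  | nil => simp [mulL2, eval2]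
  | cons a q ih =>
    simp only [mulL2, List.map_cons, eval2, eval_pmul] at ih ⊢
    rw [ih]; ring

/-- Product of `P2`'s. -/
def mul2 : P2 → P2 → P2
  | [], _ => []
  | l :: p, q => add2 (mulL2 l q) ([] :: mul2 p q)

/-- `mul2` is multiplication. -/
theorem eval2_mul2 (p q : P2) (v t : ℝ) : eval2 (mul2 p q) v t = eval2 p v t * eval2 q v t := by
  induction p with
  | nil => simp [mul2, eval2]
  | cons l p ih =>
    simp only [mul2, eval2_add2, eval2_mulL2, eval2, ih, upolyEval]
    ring

/-- Product of a `P2` with a `P3` (multiplies every `u`-coefficient). -/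
def mulL3 (a : P2) (q : P3) : P3 := q.map (mul2 a)

/-- `mulL3` is multiplication by a polynomial in `(v, t)`. -/
theorem eval3_mulL3 (a : P2) (q : P3) (u v t : ℝ) :
    eval3 (mulL3 a q) u v t = eval2 a v t * eval3 q u v t := by
  induction q with
  | nil => simp [mulL3, eval3]
  | cons b q ih =>
    simp only [mulL3, List.map_cons, eval3, eval2_mul2] at ih ⊢
    rw [ih]; ring

/-- Product of `P3`'s. -/
def mul3 : P3 → P3 → P3
  | [], _ => []
  | a :: p, q => add3 (mulL3 a q) ([] :: mul3 p q)

/-- `mul3` is multiplication. -/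
theorem eval3_mul3 (p q : P3) (u v t : ℝ) : eval3 (mul3 p q) u v t = eval3 p u v t * eval3 q u v t := by
  induction p with
  | nil => simp [mul3, eval3]
  | cons a p ih =>
    simp only [mul3, eval3_add3, eval3_mulL3, eval3, ih, eval2]
    ring

/-- The constant polynomial. -/
def cst3 (c : ℚ) : P3 := [[[c]]]

/-- `cst3` is the constant. -/
theorem eval3_cst3 (c : ℚ) (u v t : ℝ) : eval3 (cst3 c) u v t = c := by
  simp [cst3, eval3, eval2, upolyEval]

/-- A univariate coefficient list as a polynomial in `u`. -/
def ofU (l : List ℚ) : P3 := l.map fun c => [[c]]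

/-- `ofU` evaluates in `u`. -/
theorem eval3_ofU (l : List ℚ) (u v t : ℝ) : eval3 (ofU l) u v t = upolyEval l u := by
  induction l with
  | nil => simp [ofU, eval3, upolyEval]
  | cons c l ih =>
    simp only [ofU, List.map_cons, eval3, eval2, upolyEval] at ih ⊢
    rw [ih]; ring

/-- A univariate coefficient list as a polynomial in `v`. -/
def ofV (l : List ℚ) : P3 := [l.map fun c => [c]]

/-- Horner in `v` of singleton `t`-lists. -/
private theorem eval2_map_singleton (l : List ℚ) (v t : ℝ) :
    eval2 (l.map fun c => [c]) v t = upolyEval l v := by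
  induction l with
  | nil => simp [eval2, upolyEval]
  | cons c l ih =>
    simp only [List.map_cons, eval2, upolyEval] at ih ⊢
    rw [ih]; simp

/-- `ofV` evaluates in `v`. -/
theorem eval3_ofV (l : List ℚ) (u v t : ℝ) : eval3 (ofV l) u v t = upolyEval l v := by
  simp [ofV, eval3, eval2_map_singleton]

/-- A univariate coefficient list as a polynomial in `t`. -/
def ofT (l : List ℚ) : P3 := [[l]]

/-- `ofT` evaluates in `t`. -/
theorem eval3_ofT (l : List ℚ) (u v t : ℝ) : eval3 (ofT l) u v t = upolyEval l t := by
  simp [ofT, eval3, eval2]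

/-- Structural `Σ_{i<n} f i` of `P3`'s. -/
def sum3 (f : ℕ → P3) : ℕ → P3
  | 0 => []
  | n + 1 => add3 (sum3 f n) (f n)

/-- `sum3` is the range sum. -/
theorem eval3_sum3 (f : ℕ → P3) (n : ℕ) (u v t : ℝ) :
    eval3 (sum3 f n) u v t = ∑ i ∈ range n, eval3 (f i) u v t := by
  induction n with
  | zero => simp [sum3, eval3]
  | succ n ih => rw [sum3, eval3_add3, ih, Finset.sum_range_succ]

/-! ### Zero-padding equivalence and slices -/

/-- All coefficients of a list are zero. -/
def isZero1 : List ℚ → Bool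
  | [] => true
  | c :: p => decide (c = 0) && isZero1 p

/-- A zero list evaluates to `0`. -/
theorem eval_of_isZero1 (p : List ℚ) (h : isZero1 p = true) (x : ℝ) : upolyEval p x = 0 := by
  induction p with
  | nil => simp [upolyEval]
  | cons c p ih =>
    simp only [isZero1, Bool.and_eq_true, decide_eq_true_eq] at h
    simp [upolyEval, h.1, ih h.2]

/-- Two coefficient lists agree up to trailing zeros. -/
def eqv1 : List ℚ → List ℚ → Bool
  | [], q => isZero1 q
  | a :: p, [] => isZero1 (a :: p)
  | a :: p, b :: q => decide (a = b) && eqv1 p q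

/-- Equivalent lists evaluate equally. -/
theorem eval_congr_of_eqv1 : ∀ (p q : List ℚ), eqv1 p q = true → ∀ x : ℝ, upolyEval p x = upolyEval q x
  | [], q, h, x => by rw [eval_of_isZero1 q h x]; simp [upolyEval]
  | a :: p, [], h, x => by rw [eval_of_isZero1 (a :: p) h x]; simp [upolyEval]
  | a :: p, b :: q, h, x => by
    simp only [eqv1, Bool.and_eq_true, decide_eq_true_eq] at h
    simp only [upolyEval, h.1, eval_congr_of_eqv1 p q h.2 x]

/-- All coefficients of a `P2` are zero. -/
def isZero2 : P2 → Bool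
  | [] => true
  | l :: p => isZero1 l && isZero2 p

/-- A zero `P2` evaluates to `0`. -/
theorem eval2_of_isZero2 (p : P2) (h : isZero2 p = true) (v t : ℝ) : eval2 p v t = 0 := by
  induction p with
  | nil => simp [eval2]
  | cons l p ih =>
    simp only [isZero2, Bool.and_eq_true] at h
    simp [eval2, eval_of_isZero1 l h.1, ih h.2]

/-- Two `P2`'s agree up to zero padding. -/
def eqv2 : P2 → P2 → Bool
  | [], q => isZero2 q
  | a :: p, [] => isZero2 (a :: p)
  | a :: p, b :: q => eqv1 a b && eqv2 p q

/-- Equivalent `P2`'s evaluate equally. -/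
theorem eval2_congr_of_eqv2 : ∀ (p q : P2), eqv2 p q = true → ∀ v t : ℝ, eval2 p v t = eval2 q v t
  | [], q, h, v, t => by rw [eval2_of_isZero2 q h v t]; simp [eval2]
  | a :: p, [], h, v, t => by rw [eval2_of_isZero2 (a :: p) h v t]; simp [eval2]
  | a :: p, b :: q, h, v, t => by
    simp only [eqv2, Bool.and_eq_true] at h
    simp only [eval2, eval_congr_of_eqv1 a b h.1 t, eval2_congr_of_eqv2 p q h.2 v t]

/-- All coefficients of a `P3` are zero. -/
def isZero3 : P3 → Bool
  | [] => true
  | a :: p => isZero2 a && isZero3 p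

/-- A zero `P3` evaluates to `0`. -/
theorem eval3_of_isZero3 (p : P3) (h : isZero3 p = true) (u v t : ℝ) : eval3 p u v t = 0 := by
  induction p with
  | nil => simp [eval3]
  | cons a p ih =>
    simp only [isZero3, Bool.and_eq_true] at h
    simp [eval3, eval2_of_isZero2 a h.1, ih h.2]

/-- Two `P3`'s agree up to zero padding. -/
def eqv3 : P3 → P3 → Bool
  | [], q => isZero3 q
  | a :: p, [] => isZero3 (a :: p)
  | a :: p, b :: q => eqv2 a b && eqv3 p q

/-- Equivalent `P3`'s evaluate equally. -/
theorem eval3_congr_of_eqv3 : ∀ (p q : P3), eqv3 p q = true → ∀ u v t : ℝ, eval3 p u v t = eval3 q u v t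
  | [], q, h, u, v, t => by rw [eval3_of_isZero3 q h u v t]; simp [eval3]
  | a :: p, [], h, u, v, t => by rw [eval3_of_isZero3 (a :: p) h u v t]; simp [eval3]
  | a :: p, b :: q, h, u, v, t => by
    simp only [eqv3, Bool.and_eq_true] at h
    simp only [eval3, eval2_congr_of_eqv2 a b h.1 v t, eval3_congr_of_eqv3 p q h.2 u v t]

/-- `eqv2 a [] ⇒ a` is zero. -/
theorem isZero2_of_eqv2_nil : ∀ a : P2, eqv2 a [] = true → isZero2 a = true
  | [], _ => rfl
  | _ :: _, h => h

/-- Slice form of the equivalence: if every `u`-slice agrees up to padding, the `P3`'s evaluate equally. -/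
theorem eval3_congr_of_forall_slice : ∀ (p q : P3),
    (∀ i : ℕ, eqv2 (p.getD i []) (q.getD i []) = true) → ∀ u v t : ℝ, eval3 p u v t = eval3 q u v t
  | [], [], _, u, v, t => rfl
  | [], b :: q, h, u, v, t => by
    have h0 := h 0
    simp only [List.getD_nil, List.getD_cons_zero] at h0
    have htail : ∀ i : ℕ, eqv2 (([] : P3).getD i []) (q.getD i []) = true := fun i => by
      simpa using h (i + 1)
    rw [eval3, eval3, eval2_of_isZero2 b h0 v t, ← eval3_congr_of_forall_slice [] q htail u v t, eval3]
    ring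
  | a :: p, [], h, u, v, t => by
    have h0 := h 0
    simp only [List.getD_nil, List.getD_cons_zero] at h0
    have htail : ∀ i : ℕ, eqv2 (p.getD i []) (([] : P3).getD i []) = true := fun i => by
      simpa using h (i + 1)
    rw [eval3, eval3, eval2_of_isZero2 a (isZero2_of_eqv2_nil a h0) v t,
      eval3_congr_of_forall_slice p [] htail u v t, eval3]
    ring
  | a :: p, b :: q, h, u, v, t => by
    have h0 := h 0
    simp only [List.getD_cons_zero] at h0
    have htail : ∀ i : ℕ, eqv2 (p.getD i []) (q.getD i []) = true := fun i => by
      simpa using h (i + 1)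
    rw [eval3, eval3, eval2_congr_of_eqv2 a b h0 v t, eval3_congr_of_forall_slice p q htail u v t]

/-- Check the slices `lo ≤ i < lo + n` (a chunk; one `decide +kernel` per chunk). -/
def checkSlices (p q : P3) (lo : ℕ) : ℕ → Bool
  | 0 => true
  | n + 1 => eqv2 (p.getD (lo + n) []) (q.getD (lo + n) []) && checkSlices p q lo n

/-- A passing chunk certifies its slices. -/
theorem slice_of_checkSlices (p q : P3) (lo : ℕ) :
    ∀ n : ℕ, checkSlices p q lo n = true → ∀ i, lo ≤ i → i < lo + n →
      eqv2 (p.getD i []) (q.getD i []) = true := by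
  intro n
  induction n with
  | zero => intro _ i h1 h2; omega
  | succ n ih =>
    intro h i h1 h2
    simp only [checkSlices, Bool.and_eq_true] at h
    rcases Nat.lt_or_ge i (lo + n) with hlt | hge
    · exact ih h.2 i h1 hlt
    · have : i = lo + n := by omega
      subst this; exact h.1

/-- **Literal = computed, by slices**: if both `P3`'s have length `≤ n` and the slices `0 ≤ i < n` agree
(e.g. by a few `checkSlices` chunks), the two evaluate equally everywhere. -/
theorem eval3_congr_of_slices (p q : P3) (n : ℕ) (hp : p.length ≤ n) (hq : q.length ≤ n)
    (h : ∀ i, i < n → eqv2 (p.getD i []) (q.getD i []) = true) (u v t : ℝ) :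
    eval3 p u v t = eval3 q u v t := by
  refine eval3_congr_of_forall_slice p q (fun i => ?_) u v t
  rcases Nat.lt_or_ge i n with hi | hi
  · exact h i hi
  · rw [List.getD_eq_default _ _ (le_trans hp hi), List.getD_eq_default _ _ (le_trans hq hi)]
    rfl

end Summit.Ventures.Crystal3D.CapX2
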